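/-
Copyright: cell `pub-ymgap` (HUMAN RULING D-0062), Track A of `YM-PLAN.md`, DAG node N20 (= NE7b); R134 acceleration seat
`pub-ymgap-dag-n20-c` (strategy s1, generation 0), module 2.  Released under the licence of the surrounding project.
-/
import Summits.QuantumFields.YangMills.Theorems.BalabanUVNodesN20LCSPushforward
import Summits.QuantumFields.YangMills.Theorems.LangevinControlUVFemtoCurvatureTwoPointCLatticeStokes
import HarnessLib

/-!
# YM-DAG node N20 (= NE7b), strategy s1, module 2: the domination letter DISCHARGED for loop energies — local exponential
# moments of Wilson LOOP energies `N − Re tr r(hol ∂(R×T))` under the bare Wilson measure, uniformly in `β ≥ 4` and in the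
# volume (= (LS) at scale 1 for the DECIMATION block map, unconditional)

Track A of `YM-PLAN.md` (cell `pub-ymgap`, HUMAN RULING D-0062), node **N20** = spine estimate NE7b (`T4WeightBudget.RelWeightBound` —
the cell `pub-balaban`'s OWN estimate, NOT PRINTED in [Bałaban 1983–89], NOT PROVED).  Seat `pub-ymgap-dag-n20-c` (R134, s1).  Kernel
theorems only: 0 `def`, 0 `sorry`, standard axioms; COUNT-NEUTRAL; `--supports` the K3 item `SpineGivenEndpointR11` (stmt-QuantumFields-19676).
Nothing of Bałaban's is asserted or instantiated.

WHY.  Module 1 (`…Theorems.BalabanUVNodesN20LCSPushforward`, p453912) proves the transfer (LS)₀ ⇒ (LS)₁ of the tree's level-0 local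
exponential plaquette moments (`…NE7b.LocalPlaquetteExpMoments.localExpMoment`) to every family of coarse observables carrying a DOMINATION
LETTER `O_P ≤ a·β·Σ_{q∈R(P)} A_q` by the fine plaquette energies of a block region, and names that letter as located residual (i) for
Bałaban's smeared block average.  For the simplest block map — DECIMATION (the coarse link is the straight `b`-step transporter, so the coarse
plaquette IS the `b × b` Wilson loop) — and more generally for every RECTANGULAR WILSON LOOP, the letter is the lattice non-abelian Stokes
inequality in energy form, ALREADY a tree theorem on these carriers:
`FemtoCurvatureTwoPointC.LatticeStokes.sub_re_trace_map_rectangleHolonomy_le` — `N − Re tr ρ(hol ∂(R×T)) ≤ R·T·Σ_{p ⊂ R×T}(N − Re tr ρ(U_p))`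
(Frobenius subadditivity of `g ↦ ‖1 − ρ g‖` along the rectangle word + Cauchy–Schwarz).  THIS FILE composes the two.

WHAT IS PROVED ([folklore] over the tree's theorems; `r` a faithful continuous unitary lattice representation of a compact group `G`, odd
four-tori `(ℤ∕(2S+1))⁴`, `S ≥ 1`, `β ≥ 4`, the bare Wilson probability measure `wilsonMeasure r.ρ β`, energies `A(g) = N − Re tr r(g) ≥ 0`):
* §1 the FACE of a rectangle as a plaquette set: `faceShift_injOn` (the face map `(s,t) ↦ (x + s e_μ + t e_ν; μ,ν)` is injective on
  `[0,R) × [0,T)` for `R, T ≤ 2S+1`), `sum_face_eq_sum_image`, and the letter in region form **`loopEnergy_le_mul_sum_region`**: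
  `A(hol ∂(R×T)) ≤ R·T·Σ_{q∈F} A_q` for every plaquette set `F` containing the face.
* §2 **`localExpMoment_loopEnergies`** — for every finite family of rectangular loops `P ∈ Q` (base point `x_P`, plane `μ_P < ν_P`, sides
  `R_P, T_P ≤ 2S+1`, area `R_P·T_P ≤ 𝔞`) with plaquette regions `F(P) ⊇ face(P)` of size `≤ n` and multiplicity `≤ m`, and every `δ ≥ 0`
  with `m·δ·𝔞 ≤ 1∕12`: `∫ exp(δ·β·Σ_{P∈Q} A(hol ∂P)) dμ_β ≤ exp((C∕12)·n·#Q)`, `C` the constant of `localExpMoment` — module 1's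
  `localExpMoment_dominated` at the tilt `δ·𝔞`.
* §3 **`localExpMoment_loopEnergy`** — ONE loop: `∫ exp(δ·β·A(hol ∂(R×T))) dμ_β ≤ exp(C·δ·(R·T)²)` for `0 ≤ δ`, `δ·R·T ≤ 1∕12` (the loop
  energy has exponential moments at the scale `1∕(β·area)`, uniformly in `β ≥ 4` and the volume); **`localExpMoment_blockSquares`** —
  the DECIMATION reading: a family of `b × b` squares (the coarse plaquettes of the side-`b` decimation of `U`) with face regions of
  multiplicity `≤ m`, `m·δ·b² ≤ 1∕12` ⟹ `∫ exp(δ·β·Σ_P A(hol ∂P)) dμ_β ≤ exp((C∕12)·b²·#Q)` — (LS) of route NE7b R-T1 at scale `j = 1`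
  for the decimation block map, UNCONDITIONAL; by module 1 §1 it is the `LocCondStability` inequality at level 1, push-forward form, for the
  carrier `exp(δβ·Σ_{P∈Q} A_P)` of the decimated field against the unrestricted transported density.

HONEST FRAMING.  Decimation is NOT Bałaban's block average of record (`Node00` `avOfRecord`: a smeared, normalised average of transporters);
for it the domination letter holds only on small fine fields and stays located residual (i) of module 1 (with (ii) the conditional ∕
restricted form, (iii) the carrier junction, (iv) levels `≥ 2`).  NE7b NOT PRINTED ∕ NOT PROVED; (α)-instance 0∕1; N20 NOT discharged;
typed 28∕28, discharged count untouched; one finite four-torus at fixed `ε` — NOT ℝ⁴, NOT infinite volume, NOT OS, NOT a mass gap, NOT Clay.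
-/

set_option autoImplicit false

noncomputable section

namespace Summit.QuantumFields.YangMills.BalabanUVNodes.N20LCSLoopEnergies

open MeasureTheory
open Literature.MathematicalPhysics.QuantumFieldTheory
open Summit.QuantumFields.BalabanUV.T4Continuum.NE7b.LocalPlaquetteExpMoments (localExpMoment plaqEnergy_nonneg)
open Summit.QuantumFields.YangMills.Theorems.FemtoCurvatureTwoPointC.LatticeStokes (sub_re_trace_map_rectangleHolonomy_le)
open Summit.QuantumFields.YangMills.BalabanUVNodes.N20LCSPushforward (localExpMoment_dominated card_biUnion_le_mul)

/-! ## §1 The face of a rectangle as a plaquette set; the non-abelian Stokes letter in region form -/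

section Face

variable {L : ℕ}

/-- The face map `(s, t) ↦ x + s e_μ + t e_ν` (`μ ≠ ν`) is injective on `[0,R) × [0,T)` when `R, T ≤ L` (coordinates in `ZMod L`).
[folklore] -/
theorem faceShift_injOn (x : Site 4 L) {μ ν : Fin 4} (hμν : μ ≠ ν) {R T : ℕ} (hR : R ≤ L) (hT : T ≤ L) :
    Set.InjOn (fun st : ℕ × ℕ => (x + Pi.single μ (st.1 : ZMod L) + Pi.single ν (st.2 : ZMod L) : Site 4 L))
      ↑(Finset.range R ×ˢ Finset.range T) := by
  rintro ⟨s, t⟩ hst ⟨s', t'⟩ hst' h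
  simp only [Finset.coe_product, Set.mem_prod, Finset.mem_coe, Finset.mem_range] at hst hst'
  have h' : (Pi.single μ (s : ZMod L) + Pi.single ν (t : ZMod L) : Site 4 L) =
      Pi.single μ (s' : ZMod L) + Pi.single ν (t' : ZMod L) := by
    have := h
    simp only [add_assoc] at this
    exact add_left_cancel this
  have hμ := congrFun h' μ
  have hν := congrFun h' ν
  simp only [Pi.add_apply, Pi.single_eq_same, Pi.single_eq_of_ne hμν, Pi.single_eq_of_ne hμν.symm,
    add_zero, zero_add] at hμ hν
  have hs : s = s' := by
    have e := congrArg ZMod.val hμ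
    rwa [ZMod.val_cast_of_lt (lt_of_lt_of_le hst.1 hR), ZMod.val_cast_of_lt (lt_of_lt_of_le hst'.1 hR)] at e
  have ht : t = t' := by
    have e := congrArg ZMod.val hν
    rwa [ZMod.val_cast_of_lt (lt_of_lt_of_le hst.2 hT), ZMod.val_cast_of_lt (lt_of_lt_of_le hst'.2 hT)] at e
  rw [hs, ht]

/-- The face PLAQUETTE map `(s, t) ↦ (x + s e_μ + t e_ν; μ, ν)` is injective on `[0,R) × [0,T)` when `R, T ≤ L`. [folklore] -/
theorem facePlaq_injOn (x : Site 4 L) {μ ν : Fin 4} (hμν : μ < ν) {R T : ℕ} (hR : R ≤ L) (hT : T ≤ L) :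
    Set.InjOn (fun st : ℕ × ℕ =>
        ((x + Pi.single μ (st.1 : ZMod L) + Pi.single ν (st.2 : ZMod L), ⟨(μ, ν), hμν⟩) : Plaquette 4 L))
      ↑(Finset.range R ×ˢ Finset.range T) := by
  intro a ha b hb h
  exact faceShift_injOn x (ne_of_lt hμν) hR hT ha hb (congrArg Prod.fst h)

/-- The face has at most `R·T` plaquettes. [folklore] -/
theorem card_faceImage_le (x : Site 4 L) {μ ν : Fin 4} (hμν : μ < ν) (R T : ℕ) :
    ((Finset.range R ×ˢ Finset.range T).image (fun st : ℕ × ℕ =>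
        ((x + Pi.single μ (st.1 : ZMod L) + Pi.single ν (st.2 : ZMod L), ⟨(μ, ν), hμν⟩) : Plaquette 4 L))).card ≤ R * T := by
  refine Finset.card_image_le.trans ?_
  rw [Finset.card_product, Finset.card_range, Finset.card_range]

end Face

section Letter

variable {L : ℕ} {G : Type} [Group G] {N : ℕ} (ρ : G →* Matrix (Fin N) (Fin N) ℂ)

/-- The Stokes double sum over `[0,R) × [0,T)` IS the sum of the plaquette energies over the image face (injectivity). [folklore] -/
theorem sum_face_eq_sum_image (U : GaugeConfig 4 L G) (x : Site 4 L) {μ ν : Fin 4} (hμν : μ < ν) {R T : ℕ}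
    (hR : R ≤ L) (hT : T ≤ L) :
    ∑ s ∈ Finset.range R, ∑ t ∈ Finset.range T,
        ((N : ℝ) - (ρ (plaquetteHolonomy U (x + Pi.single μ (s : ZMod L) + Pi.single ν (t : ZMod L)) μ ν)).trace.re) =
      ∑ q ∈ (Finset.range R ×ˢ Finset.range T).image (fun st : ℕ × ℕ =>
          ((x + Pi.single μ (st.1 : ZMod L) + Pi.single ν (st.2 : ZMod L), ⟨(μ, ν), hμν⟩) : Plaquette 4 L)),
        ((N : ℝ) - WilsonRP.plaqRe ρ U q) := by
  rw [Finset.sum_image (facePlaq_injOn x hμν hR hT), ← Finset.sum_product']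
  rfl

/-- **THE DOMINATION LETTER FOR A LOOP ENERGY, REGION FORM.**  For a unitary representation `ρ`, a rectangle `R × T` (`R, T ≤ L`) in the
plane `μ < ν` at `x`, and ANY plaquette set `F` containing its face: `N − Re tr ρ(hol ∂(R×T)) ≤ R·T·Σ_{q∈F} (N − Re tr ρ(U_q))`
(the tree's `LatticeStokes.sub_re_trace_map_rectangleHolonomy_le`, the face rewritten as a plaquette set, and `A_q ≥ 0` off the face).
[folklore] -/
theorem loopEnergy_le_mul_sum_region [TopologicalSpace G] [IsTopologicalGroup G] [CompactSpace G]
    (hρu : ∀ g, ρ g ∈ Matrix.unitaryGroup (Fin N) ℂ) (hρc : Continuous ρ) (U : GaugeConfig 4 L G) (x : Site 4 L)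
    {μ ν : Fin 4} (hμν : μ < ν) {R T : ℕ} (hR : R ≤ L) (hT : T ≤ L) (F : Finset (Plaquette 4 L))
    (hF : (Finset.range R ×ˢ Finset.range T).image (fun st : ℕ × ℕ =>
        ((x + Pi.single μ (st.1 : ZMod L) + Pi.single ν (st.2 : ZMod L), ⟨(μ, ν), hμν⟩) : Plaquette 4 L)) ⊆ F) :
    (N : ℝ) - (ρ (rectangleHolonomy U x μ ν R T)).trace.re ≤ ((R * T : ℕ) : ℝ) * ∑ q ∈ F, ((N : ℝ) - WilsonRP.plaqRe ρ U q) := by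
  refine (sub_re_trace_map_rectangleHolonomy_le ρ hρu U μ ν R T x).trans ?_
  rw [sum_face_eq_sum_image ρ U x hμν hR hT]
  exact mul_le_mul_of_nonneg_left
    (Finset.sum_le_sum_of_subset_of_nonneg hF fun q _ _ => plaqEnergy_nonneg ρ hρc U q) (Nat.cast_nonneg _)

end Letter

/-! ## §2 Local exponential moments of a family of loop energies -/

section Loops

variable {G : Type} [Group G] [TopologicalSpace G] [IsTopologicalGroup G] [CompactSpace G]
  [MeasurableSpace G] [BorelSpace G]

/-- **LOCAL EXPONENTIAL MOMENTS OF WILSON LOOP ENERGIES.**  For a faithful continuous unitary lattice representation `r` of a compact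
group `G` there is `C ≥ 0` (the constant of `localExpMoment`) such that for every odd four-torus `(ℤ∕(2S+1))⁴` (`S ≥ 1`), every `β ≥ 4`,
every finite family of rectangular loops `P ∈ Q` — base point `x P`, plane `μ P < ν P`, sides `R P, T P ≤ 2S+1`, area `R P · T P ≤ 𝔞` — with
plaquette regions `F P ⊇ face P` of size `≤ n` and multiplicity `≤ m`, and every `δ ≥ 0` with `m·δ·𝔞 ≤ 1∕12`:
`∫ exp(δ·β·Σ_{P∈Q} (N − Re tr r(hol ∂P))) dμ_β ≤ exp((C∕12)·n·#Q)` — uniformly in `β` and in the volume.  Module 1's transfer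
`localExpMoment_dominated` at the tilt `δ·𝔞`, the letter being `loopEnergy_le_mul_sum_region`. [folklore] -/
theorem localExpMoment_loopEnergies (r : LatticeRep G) :
    ∃ C : ℝ, 0 ≤ C ∧ ∀ (S : ℕ), 1 ≤ S → ∀ (β : ℝ), 4 ≤ β →
      ∀ (κ : Type) (Q : Finset κ) (x : κ → Site 4 (2 * S + 1)) (μ ν : κ → Fin 4) (hμν : ∀ P, μ P < ν P)
        (R T : κ → ℕ) (F : κ → Finset (Plaquette 4 (2 * S + 1))) (𝔞 m n : ℕ) (δ : ℝ),
        0 ≤ δ → (m : ℝ) * (δ * 𝔞) ≤ 1 / 12 →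
        (∀ P ∈ Q, R P ≤ 2 * S + 1) → (∀ P ∈ Q, T P ≤ 2 * S + 1) → (∀ P ∈ Q, R P * T P ≤ 𝔞) →
        (∀ P ∈ Q, (Finset.range (R P) ×ˢ Finset.range (T P)).image (fun st : ℕ × ℕ =>
            ((x P + Pi.single (μ P) (st.1 : ZMod (2 * S + 1)) + Pi.single (ν P) (st.2 : ZMod (2 * S + 1)),
              ⟨(μ P, ν P), hμν P⟩) : Plaquette 4 (2 * S + 1))) ⊆ F P) →
        (∀ q ∈ Q.biUnion F, (Q.filter fun P => q ∈ F P).card ≤ m) → (∀ P ∈ Q, (F P).card ≤ n) →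
        ∫ U, Real.exp (δ * β * ∑ P ∈ Q, ((r.N : ℝ) - (r.ρ (rectangleHolonomy U (x P) (μ P) (ν P) (R P) (T P))).trace.re))
            ∂(wilsonMeasure r.ρ β : Measure (GaugeConfig 4 (2 * S + 1) G)) ≤
          Real.exp (C / 12 * (n * Q.card)) := by
  obtain ⟨C, hC0, hC⟩ := localExpMoment_dominated r
  refine ⟨C, hC0, fun S hS β hβ κ Q x μ ν hμν R T F 𝔞 m n δ hδ hsmall hR hT hA hF hmult hn => ?_⟩
  classical
  have hβ0 : 0 ≤ β := by linarith
  have ha : 0 ≤ δ * 𝔞 := mul_nonneg hδ (Nat.cast_nonneg _)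
  -- the letter: each tilted loop energy is dominated by `(δ𝔞)·β·Σ_{F P} A_q`
  have hdom : ∀ P ∈ Q, ∀ U : GaugeConfig 4 (2 * S + 1) G,
      δ * β * ((r.N : ℝ) - (r.ρ (rectangleHolonomy U (x P) (μ P) (ν P) (R P) (T P))).trace.re) ≤
        δ * 𝔞 * β * ∑ q ∈ F P, ((r.N : ℝ) - WilsonRP.plaqRe r.ρ U q) := by
    intro P hP U
    have h1 := loopEnergy_le_mul_sum_region r.ρ r.mem_unitary r.continuous U (x P) (hμν P) (hR P hP) (hT P hP)
      (F P) (hF P hP)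
    have hS0 : 0 ≤ ∑ q ∈ F P, ((r.N : ℝ) - WilsonRP.plaqRe r.ρ U q) :=
      Finset.sum_nonneg fun q _ => plaqEnergy_nonneg r.ρ r.continuous U q
    have h2 : (((R P * T P : ℕ) : ℝ)) * ∑ q ∈ F P, ((r.N : ℝ) - WilsonRP.plaqRe r.ρ U q) ≤
        (𝔞 : ℝ) * ∑ q ∈ F P, ((r.N : ℝ) - WilsonRP.plaqRe r.ρ U q) :=
      mul_le_mul_of_nonneg_right (by exact_mod_cast hA P hP) hS0
    have hδβ : 0 ≤ δ * β := mul_nonneg hδ hβ0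
    calc δ * β * ((r.N : ℝ) - (r.ρ (rectangleHolonomy U (x P) (μ P) (ν P) (R P) (T P))).trace.re)
        ≤ δ * β * ((𝔞 : ℝ) * ∑ q ∈ F P, ((r.N : ℝ) - WilsonRP.plaqRe r.ρ U q)) :=
          mul_le_mul_of_nonneg_left (h1.trans h2) hδβ
      _ = δ * 𝔞 * β * ∑ q ∈ F P, ((r.N : ℝ) - WilsonRP.plaqRe r.ρ U q) := by ring
  have hmain := hC S hS β hβ κ Q F
    (fun P U => δ * β * ((r.N : ℝ) - (r.ρ (rectangleHolonomy U (x P) (μ P) (ν P) (R P) (T P))).trace.re))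
    (δ * 𝔞) m ha hsmall hmult hdom
  have hsum : ∀ U : GaugeConfig 4 (2 * S + 1) G,
      ∑ P ∈ Q, δ * β * ((r.N : ℝ) - (r.ρ (rectangleHolonomy U (x P) (μ P) (ν P) (R P) (T P))).trace.re) =
        δ * β * ∑ P ∈ Q, ((r.N : ℝ) - (r.ρ (rectangleHolonomy U (x P) (μ P) (ν P) (R P) (T P))).trace.re) :=
    fun U => by rw [Finset.mul_sum]
  simp_rw [hsum] at hmain
  refine hmain.trans (Real.exp_le_exp.2 ?_)
  have hcard : ((Q.biUnion F).card : ℝ) ≤ n * Q.card := by exact_mod_cast card_biUnion_le_mul Q F n hn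
  have h2 : 0 ≤ C * (m * (δ * 𝔞)) := mul_nonneg hC0 (mul_nonneg (Nat.cast_nonneg m) ha)
  calc C * (m * (δ * 𝔞)) * ((Q.biUnion F).card : ℝ) ≤ C * (m * (δ * 𝔞)) * (n * Q.card) :=
        mul_le_mul_of_nonneg_left hcard h2
    _ ≤ C * (1 / 12) * (n * Q.card) :=
        mul_le_mul_of_nonneg_right (mul_le_mul_of_nonneg_left hsmall hC0) (by positivity)
    _ = C / 12 * (n * Q.card) := by ring

/-! ## §3 One loop; the decimation reading -/

/-- **ONE WILSON LOOP: ITS ENERGY HAS EXPONENTIAL MOMENTS AT THE SCALE `1∕(β·area)`.**  With the constant `C` of `localExpMoment`: for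
every odd four-torus `(ℤ∕(2S+1))⁴` (`S ≥ 1`), every `β ≥ 4`, every rectangle `R × T` (`R, T ≤ 2S+1`) in a plane `μ < ν` at any base point,
and every `δ ≥ 0` with `δ·R·T ≤ 1∕12`: `∫ exp(δ·β·(N − Re tr r(hol ∂(R×T)))) dμ_β ≤ exp(C·δ·(R·T)²)` — uniformly in `β` and the volume.
[folklore] -/
theorem localExpMoment_loopEnergy (r : LatticeRep G) :
    ∃ C : ℝ, 0 ≤ C ∧ ∀ (S : ℕ), 1 ≤ S → ∀ (β : ℝ), 4 ≤ β →
      ∀ (x : Site 4 (2 * S + 1)) (μ ν : Fin 4) (_hμν : μ < ν) (R T : ℕ) (δ : ℝ),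
        0 ≤ δ → δ * (R * T) ≤ 1 / 12 → R ≤ 2 * S + 1 → T ≤ 2 * S + 1 →
        ∫ U, Real.exp (δ * β * ((r.N : ℝ) - (r.ρ (rectangleHolonomy U x μ ν R T)).trace.re))
            ∂(wilsonMeasure r.ρ β : Measure (GaugeConfig 4 (2 * S + 1) G)) ≤
          Real.exp (C * δ * (R * T) ^ 2) := by
  obtain ⟨C, hC0, hC⟩ := localExpMoment_dominated r
  refine ⟨C, hC0, fun S hS β hβ x μ ν hμν R T δ hδ hsmall hR hT => ?_⟩
  classical
  have hβ0 : 0 ≤ β := by linarith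
  -- the family with one member, region = the face itself, multiplicity 1, tilt `δ·(R·T)`
  set face : Finset (Plaquette 4 (2 * S + 1)) := (Finset.range R ×ˢ Finset.range T).image (fun st : ℕ × ℕ =>
    ((x + Pi.single μ (st.1 : ZMod (2 * S + 1)) + Pi.single ν (st.2 : ZMod (2 * S + 1)), ⟨(μ, ν), hμν⟩) :
      Plaquette 4 (2 * S + 1))) with hface
  have ha : 0 ≤ δ * ((R * T : ℕ) : ℝ) := mul_nonneg hδ (Nat.cast_nonneg _)
  have hma : ((1 : ℕ) : ℝ) * (δ * ((R * T : ℕ) : ℝ)) ≤ 1 / 12 := by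
    rw [Nat.cast_one, one_mul, Nat.cast_mul]; exact hsmall
  have hdom : ∀ P ∈ ({()} : Finset Unit), ∀ U : GaugeConfig 4 (2 * S + 1) G,
      δ * β * ((r.N : ℝ) - (r.ρ (rectangleHolonomy U x μ ν R T)).trace.re) ≤
        δ * ((R * T : ℕ) : ℝ) * β * ∑ q ∈ face, ((r.N : ℝ) - WilsonRP.plaqRe r.ρ U q) := by
    intro _ _ U
    have h1 := loopEnergy_le_mul_sum_region r.ρ r.mem_unitary r.continuous U x hμν hR hT face (by rw [hface])
    have hδβ : 0 ≤ δ * β := mul_nonneg hδ hβ0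
    calc δ * β * ((r.N : ℝ) - (r.ρ (rectangleHolonomy U x μ ν R T)).trace.re)
        ≤ δ * β * (((R * T : ℕ) : ℝ) * ∑ q ∈ face, ((r.N : ℝ) - WilsonRP.plaqRe r.ρ U q)) :=
          mul_le_mul_of_nonneg_left h1 hδβ
      _ = δ * ((R * T : ℕ) : ℝ) * β * ∑ q ∈ face, ((r.N : ℝ) - WilsonRP.plaqRe r.ρ U q) := by ring
  have hmult : ∀ q ∈ ({()} : Finset Unit).biUnion (fun _ => face),
      (({()} : Finset Unit).filter fun P => q ∈ (fun _ => face) P).card ≤ 1 := fun q _ =>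
    (Finset.card_filter_le _ _).trans (by simp)
  have hmain := hC S hS β hβ Unit {()} (fun _ => face)
    (fun _ U => δ * β * ((r.N : ℝ) - (r.ρ (rectangleHolonomy U x μ ν R T)).trace.re))
    (δ * ((R * T : ℕ) : ℝ)) 1 ha hma hmult hdom
  simp only [Finset.sum_singleton, Finset.singleton_biUnion] at hmain
  refine hmain.trans (Real.exp_le_exp.2 ?_)
  have hcardface : (face.card : ℝ) ≤ ((R * T : ℕ) : ℝ) := by exact_mod_cast card_faceImage_le x hμν R T
  have h2 : 0 ≤ C * (((1 : ℕ) : ℝ) * (δ * ((R * T : ℕ) : ℝ))) := mul_nonneg hC0 (by rw [Nat.cast_one, one_mul]; exact ha)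
  calc C * (((1 : ℕ) : ℝ) * (δ * ((R * T : ℕ) : ℝ))) * (face.card : ℝ)
      ≤ C * (((1 : ℕ) : ℝ) * (δ * ((R * T : ℕ) : ℝ))) * ((R * T : ℕ) : ℝ) := mul_le_mul_of_nonneg_left hcardface h2
    _ = C * δ * ((R : ℝ) * T) ^ 2 := by push_cast; ring

/-- **THE DECIMATION READING — (LS) AT SCALE 1 FOR THE DECIMATION BLOCK MAP, UNCONDITIONAL.**  The coarse plaquettes of the side-`b`
decimation of `U` (coarse link = the straight `b`-step transporter `lineHolonomy`) are the `b × b` Wilson loops `hol ∂(b×b)` at the block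
corners; for every finite family of such squares (base points `x P`, planes `μ P < ν P`, `b ≤ 2S+1`) whose faces have multiplicity `≤ m` (for
the corners of ONE decimation lattice and one plane, `m = 1`), and every `δ ≥ 0` with `m·δ·b² ≤ 1∕12`:
`∫ exp(δ·β·Σ_{P∈Q} (N − Re tr r(hol ∂P))) dμ_β ≤ exp((C∕12)·b²·#Q)` — local exponential moments of the DECIMATED field's plaquette
energies under the bare Wilson measure, uniformly in `β ≥ 4` and in the volume.  By module 1 §1 (`lcs_coarse_iff_fine`) this is the
`LocCondStability` inequality at the first decimated level, push-forward form, for the carrier `exp(δβ·Σ_{P∈Q} A_P)` against the unrestricted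
transported density. [folklore] -/
theorem localExpMoment_blockSquares (r : LatticeRep G) :
    ∃ C : ℝ, 0 ≤ C ∧ ∀ (S : ℕ), 1 ≤ S → ∀ (β : ℝ), 4 ≤ β →
      ∀ (κ : Type) (Q : Finset κ) (x : κ → Site 4 (2 * S + 1)) (μ ν : κ → Fin 4) (hμν : ∀ P, μ P < ν P)
        (b m : ℕ) (δ : ℝ), 0 ≤ δ → (m : ℝ) * (δ * ((b * b : ℕ) : ℝ)) ≤ 1 / 12 → b ≤ 2 * S + 1 →
        (∀ q ∈ Q.biUnion (fun P => (Finset.range b ×ˢ Finset.range b).image (fun st : ℕ × ℕ =>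
            ((x P + Pi.single (μ P) (st.1 : ZMod (2 * S + 1)) + Pi.single (ν P) (st.2 : ZMod (2 * S + 1)),
              ⟨(μ P, ν P), hμν P⟩) : Plaquette 4 (2 * S + 1)))),
          (Q.filter fun P => q ∈ (Finset.range b ×ˢ Finset.range b).image (fun st : ℕ × ℕ =>
            ((x P + Pi.single (μ P) (st.1 : ZMod (2 * S + 1)) + Pi.single (ν P) (st.2 : ZMod (2 * S + 1)),
              ⟨(μ P, ν P), hμν P⟩) : Plaquette 4 (2 * S + 1)))).card ≤ m) →
        ∫ U, Real.exp (δ * β * ∑ P ∈ Q, ((r.N : ℝ) - (r.ρ (rectangleHolonomy U (x P) (μ P) (ν P) b b)).trace.re))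
            ∂(wilsonMeasure r.ρ β : Measure (GaugeConfig 4 (2 * S + 1) G)) ≤
          Real.exp (C / 12 * ((b * b : ℕ) * Q.card)) := by
  obtain ⟨C, hC0, hC⟩ := localExpMoment_loopEnergies r
  refine ⟨C, hC0, fun S hS β hβ κ Q x μ ν hμν b m δ hδ hsmall hb hmult => ?_⟩
  set F : κ → Finset (Plaquette 4 (2 * S + 1)) := fun P => (Finset.range b ×ˢ Finset.range b).image (fun st : ℕ × ℕ =>
      ((x P + Pi.single (μ P) (st.1 : ZMod (2 * S + 1)) + Pi.single (ν P) (st.2 : ZMod (2 * S + 1)),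
        ⟨(μ P, ν P), hμν P⟩) : Plaquette 4 (2 * S + 1))) with hF
  have h := hC S hS β hβ κ Q x μ ν hμν (fun _ => b) (fun _ => b) F (b * b) m (b * b) δ hδ hsmall
    (fun _ _ => hb) (fun _ _ => hb) (fun _ _ => le_rfl) (fun P _ => by rw [hF]) hmult
    (fun P _ => card_faceImage_le (x P) (hμν P) b b)
  exact h

end Loops

end Summit.QuantumFields.YangMills.BalabanUVNodes.N20LCSLoopEnergies

end
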